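import Mathlib
import HarnessLib
import Literature.MathematicalPhysics.QuantumLattice.HubbardModelThermodynamicLimitProofs
import Literature.MathematicalPhysics.QuantumLattice.FermionRelabelling
import Literature.MathematicalPhysics.QuantumLattice.FinDimSpectrumProofs
import Literature.MathematicalPhysics.QuantumLattice.HubbardCommutatorBound
import Literature.MathematicalPhysics.QuantumLattice.GroundStateSourceBounds
import Summits.HubbardSuperconductivity.HubbardSuperconductivity.Theorems.WeakCouplingBCSWcbcsBcsConstructionHamiltonianNormBound

/-!
# Route `WeakCouplingBCS` — crux `WcbcsBcsConstruction` (stmt-HubbardSuperconductivity-2010),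
# line `lro-seed-kink-bridge`: grand-canonical cuts and Hubbard rectangles

Support file (`--supports stmt-HubbardSuperconductivity-2010`, registered sub-goal
`stub_wcbcsBoxTilingRectangles`) for the stub `stub_boxTiling` of the line `lro-seed-kink-bridge`
(`WeakCouplingBCSWcbcsBcsConstructionBoxTiling.lean`). Facts about the grand-canonical ground
energy `E₀(H_G(t,U) - μN)` (`Matrix.groundEnergy (hamiltonianWith G t U μ)`) of the Hubbard model
on a finite graph `G` (namespace `WcbcsBoxTiling`):

* `gc_groundEnergy_eq_of_iso`: invariance under graph isomorphisms (`relabel` is an algebra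
  equivalence, spectra agree); `gc_groundEnergy_nonpos`: `E₀ ≤ 0` (vacuum trial state);
  `neg_le_gc_groundEnergy_of_degree_le`: `E₀ ≥ -(Δ+1)|Λ|(2|t|+|U|+2|μ|)` (degree `≤ Δ`);
* `gc_groundEnergy_le_add_of_cut`: **sub-additivity under induced order-cuts**,
  `E₀(G) ≤ E₀(G₁) + E₀(G₂)` when the ordered site set of `G` is the ordered disjoint union of those
  of `G₁`, `G₂` with induced adjacencies, GIVEN that the grand-canonical ground energy is the
  minimum over particle numbers of the sector energies (the registered stub
  `stub_gcGroundEnergyEqMin`, a hypothesis here): minimising sectors `N₁`, `N₂` of the blocks,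
  trial sector `N₁ + N₂`, and `groundEnergyAt_le_add_of_cut` (cross bonds have zero expectation);
* rectangles `Lex (Fin m × Fin n)` (row-major lexicographic order) with the nearest-neighbour graph
  pulled back from `ℤ²` along `p ↦ (p.1, p.2)`: degree `≤ 4`, the volume lower bound, the
  transposition isomorphism `E₀(n,m) = E₀(m,n)`, the row cut `E₀(m₁+m₂,n) ≤ E₀(m₁,n) + E₀(m₂,n)`,
  and (`stub_wcbcsBoxTilingRectangles`) stacking: `E₀(kM,n) ≤ k E₀(M,n)`.

Ruelle, *Statistical Mechanics* (1969) §2.1–2.2 (thermodynamic limit by sub-additivity). No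
definitions; everything is proved.
-/

set_option linter.dupNamespace false

namespace Summit.HubbardSuperconductivity.HubbardSuperconductivity.Theorems

open Literature.MathematicalPhysics.QuantumLattice Literature.Probability.LatticeModels Matrix Filter
open scoped Matrix.Norms.L2Operator ComplexOrder Topology

namespace WcbcsBoxTiling

/-! ### General graphs -/

/-- **Invariance of the grand-canonical ground energy under graph isomorphisms**: a site bijection
carrying the adjacency of `G` onto that of `G'` is implemented by the algebra equivalence `relabel`
(`relabel_hamiltonianWith`), which preserves spectra. [folklore] -/
theorem gc_groundEnergy_eq_of_iso {Λ Λ' : Type*} [LinearOrder Λ] [LinearOrder Λ'] [Fintype Λ]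
    [Fintype Λ'] (G : SimpleGraph Λ) [DecidableRel G.Adj] (G' : SimpleGraph Λ') [DecidableRel G'.Adj]
    (f : Λ ≃ Λ') (hG : ∀ x y, G'.Adj (f x) (f y) ↔ G.Adj x y) (t U μ : ℝ) :
    (hamiltonianWith G' t U μ).groundEnergy = (hamiltonianWith G t U μ).groundEnergy := by
  rw [← relabel_hamiltonianWith G G' f hG t U μ]
  unfold Matrix.groundEnergy ContinuousLinearMap.groundEnergy
  rw [Matrix.spectrum_toEuclideanCLM, Matrix.spectrum_toEuclideanCLM, AlgEquiv.spectrum_eq]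

/-- The grand-canonical Hubbard Hamiltonian annihilates the vacuum: `(H(t,U) - μN)|0⟩ = 0`.
[folklore] -/
theorem hamiltonianWith_mulVec_vacuum {Λ : Type*} [LinearOrder Λ] [Fintype Λ] (G : SimpleGraph Λ)
    [DecidableRel G.Adj] (t U μ : ℝ) :
    hamiltonianWith G t U μ *ᵥ (vacuum : Fock (Orb Λ)) = 0 := by
  have han : ∀ (x : Λ) (σ : Fin 2), numberOp x σ *ᵥ (vacuum : Fock (Orb Λ)) = 0 := fun x σ => by
    rw [numberOp, ← mulVec_mulVec, annihilation_mulVec_vacuum_holds, mulVec_zero]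
  rw [hamiltonianWith, sub_mulVec, hamiltonian_mulVec_vacuum, smul_mulVec, totalNumber,
    Matrix.sum_mulVec, zero_sub, neg_eq_zero, smul_eq_zero]
  refine Or.inr (Finset.sum_eq_zero fun x _ => ?_)
  rw [Matrix.sum_mulVec]
  exact Finset.sum_eq_zero fun σ _ => han x σ

/-- **The grand-canonical ground energy is non-positive**: the vacuum is a unit trial vector of
energy `0` (variational principle `groundEnergy_le_rayleigh`). [folklore] -/
theorem gc_groundEnergy_nonpos {Λ : Type*} [LinearOrder Λ] [Fintype Λ] (G : SimpleGraph Λ)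
    [DecidableRel G.Adj] (t U μ : ℝ) : (hamiltonianWith G t U μ).groundEnergy ≤ 0 := by
  have h1 : star (vacuum : Fock (Orb Λ)) ⬝ᵥ (vacuum : Fock (Orb Λ)) = 1 := by
    simp [vacuum]
  have h := Matrix.groundEnergy_le_rayleigh_holds (isHermitian_hamiltonianWith G t U μ) vacuum h1
  rwa [hamiltonianWith_mulVec_vacuum, dotProduct_zero, Complex.zero_re] at h

/-- **Volume lower bound**: on a finite graph of maximal degree `≤ Δ` the grand-canonical ground
energy is at least `-(Δ+1)|Λ|(2|t|+|U|+2|μ|)` (`E₀ ≥ -‖H‖`, `H = Σ_Z h_Z` over at most `(Δ+1)|Λ|`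
local terms of norm `≤ 2|t|+|U|+2|μ|`). [folklore] -/
theorem neg_le_gc_groundEnergy_of_degree_le {Λ : Type*} [LinearOrder Λ] [Fintype Λ]
    (G : SimpleGraph Λ) [DecidableRel G.Adj] {Δ : ℕ}
    (hΔ : ∀ x : Λ, (Finset.univ.filter fun y => G.Adj x y).card ≤ Δ) (t U μ : ℝ) :
    -(((Δ : ℝ) + 1) * Fintype.card Λ * (2 * |t| + |U| + 2 * |μ|)) ≤
      (hamiltonianWith G t U μ).groundEnergy := by
  have hcard : (Fintype.card (HubbardIdx G) : ℝ) ≤ ((Δ : ℝ) + 1) * Fintype.card Λ := by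
    exact_mod_cast card_hubbardIdx_le_of_degree_le G hΔ
  have hnorm : ‖hamiltonianWith G t U μ‖ ≤
      ((Δ : ℝ) + 1) * Fintype.card Λ * (2 * |t| + |U| + 2 * |μ|) := by
    rw [← sum_hubbardTermOp]
    calc ‖∑ Z, hubbardTermOp G t U μ Z‖ ≤ ∑ Z, ‖hubbardTermOp G t U μ Z‖ := norm_sum_le _ _
      _ ≤ ∑ _Z : HubbardIdx G, (2 * |t| + |U| + 2 * |μ|) :=
          Finset.sum_le_sum fun Z _ => norm_hubbardTermOp_le G t U μ Z
      _ = (Fintype.card (HubbardIdx G) : ℝ) * (2 * |t| + |U| + 2 * |μ|) := by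
          rw [Finset.sum_const, nsmul_eq_mul, Finset.card_univ]
      _ ≤ ((Δ : ℝ) + 1) * Fintype.card Λ * (2 * |t| + |U| + 2 * |μ|) :=
          mul_le_mul_of_nonneg_right hcard (by positivity)
  have h := neg_norm_le_groundEnergy (isHermitian_hamiltonianWith G t U μ)
  linarith

/-- The site set of a graph cut into two blocks along injective maps with disjoint, covering
ranges has `|Λ| = |Λ₁| + |Λ₂|`. [folklore] -/
theorem card_eq_add_of_cover {Λ₁ Λ₂ Λ : Type*} [Fintype Λ₁] [Fintype Λ₂] [Fintype Λ]
    {e₁ : Λ₁ → Λ} {e₂ : Λ₂ → Λ} (h₁ : Function.Injective e₁) (h₂ : Function.Injective e₂)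
    (hne : ∀ x y, e₁ x ≠ e₂ y) (hcov : ∀ z, (∃ x, e₁ x = z) ∨ ∃ y, e₂ y = z) :
    Fintype.card Λ = Fintype.card Λ₁ + Fintype.card Λ₂ := by
  have hbij : Function.Bijective (Sum.elim e₁ e₂) := by
    refine ⟨h₁.sumElim h₂ hne, fun z => ?_⟩
    rcases hcov z with ⟨x, rfl⟩ | ⟨y, rfl⟩
    · exact ⟨Sum.inl x, rfl⟩
    · exact ⟨Sum.inr y, rfl⟩
  rw [← Fintype.card_congr (Equiv.ofBijective _ hbij), Fintype.card_sum]

/-- **Sub-additivity of the grand-canonical ground energy under induced order-cuts.** Assume the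
grand-canonical ground energy of every finite Hubbard graph is the minimum over particle numbers
`N ≤ 2|Λ|` of the sector energies `E(N) - μN` (`hmin`, the registered stub
`stub_gcGroundEnergyEqMin`). If the linearly ordered site set of `G` is the ordered disjoint union
of those of `G₁` (below, along `e₁`) and `G₂` (above, along `e₂`), both strictly monotone, with the
adjacency of `G` inducing exactly those of `G₁` and `G₂` on the blocks (bonds across the cut are
allowed and cost nothing), then `E₀(H_G - μN) ≤ E₀(H_{G₁} - μN) + E₀(H_{G₂} - μN)`: minimising
sectors `N₁`, `N₂` of the blocks give the trial sector `N₁ + N₂ ≤ 2|Λ|`, and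
`groundEnergyAt_le_add_of_cut` applies with no mismatched pairs. Ruelle (1969) §2.2. [folklore] -/
theorem gc_groundEnergy_le_add_of_cut
    (hmin : ∀ {Λ : Type} [LinearOrder Λ] [Fintype Λ] (G : SimpleGraph Λ) [DecidableRel G.Adj]
      (t U μ : ℝ), (hamiltonianWith G t U μ).groundEnergy =
        ⨅ N : Fin (2 * Fintype.card Λ + 1), (groundEnergyAt G t U (N : ℕ) - μ * ((N : ℕ) : ℝ)))
    {Λ₁ Λ₂ Λ : Type} [LinearOrder Λ₁] [Fintype Λ₁] [LinearOrder Λ₂] [Fintype Λ₂] [LinearOrder Λ]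
    [Fintype Λ] (G₁ : SimpleGraph Λ₁) (G₂ : SimpleGraph Λ₂) (G : SimpleGraph Λ) [DecidableRel G₁.Adj]
    [DecidableRel G₂.Adj] [DecidableRel G.Adj] {e₁ : Λ₁ → Λ} {e₂ : Λ₂ → Λ} (he₁ : StrictMono e₁)
    (he₂ : StrictMono e₂) (h12 : ∀ x y, e₁ x < e₂ y) (hcov : ∀ z, (∃ x, e₁ x = z) ∨ ∃ y, e₂ y = z)
    (hG₁ : ∀ x x', G.Adj (e₁ x) (e₁ x') ↔ G₁.Adj x x') (hG₂ : ∀ y y', G.Adj (e₂ y) (e₂ y') ↔ G₂.Adj y y')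
    (t U μ : ℝ) :
    (hamiltonianWith G t U μ).groundEnergy ≤
      (hamiltonianWith G₁ t U μ).groundEnergy + (hamiltonianWith G₂ t U μ).groundEnergy := by
  have hcard : Fintype.card Λ = Fintype.card Λ₁ + Fintype.card Λ₂ :=
    card_eq_add_of_cover he₁.injective he₂.injective (fun x y => (h12 x y).ne) hcov
  have hk₁ : (Finset.univ.filter fun p : Λ₁ × Λ₁ =>
      ¬ (G.Adj (e₁ p.1) (e₁ p.2) ↔ G₁.Adj p.1 p.2)).card ≤ 0 := by
    rw [Nat.le_zero, Finset.card_eq_zero, Finset.filter_eq_empty_iff]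
    exact fun p _ h => h (hG₁ p.1 p.2)
  have hk₂ : (Finset.univ.filter fun p : Λ₂ × Λ₂ =>
      ¬ (G.Adj (e₂ p.1) (e₂ p.2) ↔ G₂.Adj p.1 p.2)).card ≤ 0 := by
    rw [Nat.le_zero, Finset.card_eq_zero, Finset.filter_eq_empty_iff]
    exact fun p _ h => h (hG₂ p.1 p.2)
  rw [hmin G t U μ, hmin G₁ t U μ, hmin G₂ t U μ]
  obtain ⟨N₁, hN₁⟩ := exists_eq_ciInf_of_finite
    (f := fun N : Fin (2 * Fintype.card Λ₁ + 1) => groundEnergyAt G₁ t U (N : ℕ) - μ * ((N : ℕ) : ℝ))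
  obtain ⟨N₂, hN₂⟩ := exists_eq_ciInf_of_finite
    (f := fun N : Fin (2 * Fintype.card Λ₂ + 1) => groundEnergyAt G₂ t U (N : ℕ) - μ * ((N : ℕ) : ℝ))
  have hN₁lt := N₁.isLt
  have hN₂lt := N₂.isLt
  have hcut := ThermodynamicLimit.groundEnergyAt_le_add_of_cut G₁ G₂ G he₁ he₂ h12 hcov hk₁ hk₂ t U
    (N₁ := N₁) (N₂ := N₂) (by omega) (by omega)
  have hlt : (N₁ : ℕ) + N₂ < 2 * Fintype.card Λ + 1 := by rw [hcard]; omega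
  have hle := ciInf_le (Set.finite_range fun N : Fin (2 * Fintype.card Λ + 1) =>
    groundEnergyAt G t U (N : ℕ) - μ * ((N : ℕ) : ℝ)).bddBelow ⟨(N₁ : ℕ) + N₂, hlt⟩
  push_cast at hcut hle ⊢
  linarith

/-! ### Rectangles

The `m × n` rectangle is the vertex type `Lex (Fin m × Fin n)` (row-major lexicographic order) with
the nearest-neighbour graph
`(zdGraph 2).comap (fun p : Lex (Fin m × Fin n) => ![((ofLex p).1 : ℤ), ((ofLex p).2 : ℤ)])`
pulled back from `ℤ²` (written out in full below: no definitions in a `Theorems` file). -/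

/-- Adjacency of `ℤ²` in coordinates: `(a,b) ∼ (c,d)` iff they differ by a unit vector. [folklore] -/
theorem zdGraph_two_adj_iff (a b c d : ℤ) :
    (zdGraph 2).Adj ![a, b] ![c, d] ↔
      (c = a + 1 ∧ d = b) ∨ (d = b + 1 ∧ c = a) ∨ (a = c + 1 ∧ b = d) ∨ (b = d + 1 ∧ a = c) := by
  rw [zdGraph_adj_iff, Fin.exists_fin_two]
  simp only [funext_iff, Fin.forall_fin_two, Pi.add_apply, Matrix.cons_val_zero,
    Matrix.cons_val_one, Pi.single_apply, if_true, if_false, add_zero, one_ne_zero, zero_ne_one]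
  tauto

/-- Adjacency of the rectangle graph in coordinates. [folklore] -/
theorem rect_adj_iff {m n : ℕ} (p q : Lex (Fin m × Fin n)) :
    ((zdGraph 2).comap (fun p : Lex (Fin m × Fin n) => ![((ofLex p).1 : ℤ), ((ofLex p).2 : ℤ)])).Adj
        p q ↔
      (((ofLex q).1 : ℕ) = (ofLex p).1 + 1 ∧ ((ofLex q).2 : ℕ) = (ofLex p).2) ∨
      (((ofLex q).2 : ℕ) = (ofLex p).2 + 1 ∧ ((ofLex q).1 : ℕ) = (ofLex p).1) ∨
      (((ofLex p).1 : ℕ) = (ofLex q).1 + 1 ∧ ((ofLex p).2 : ℕ) = (ofLex q).2) ∨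
      (((ofLex p).2 : ℕ) = (ofLex q).2 + 1 ∧ ((ofLex p).1 : ℕ) = (ofLex q).1) := by
  rw [SimpleGraph.comap_adj, zdGraph_two_adj_iff]
  omega

/-- Rectangle sites are determined by their two coordinates. [folklore] -/
theorem rect_ext {m n : ℕ} {p q : Lex (Fin m × Fin n)} (h1 : ((ofLex p).1 : ℕ) = (ofLex q).1)
    (h2 : ((ofLex p).2 : ℕ) = (ofLex q).2) : p = q :=
  ofLex.injective (Prod.ext (Fin.ext h1) (Fin.ext h2))

/-- Every site of the rectangle has at most four neighbours. [folklore] -/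
theorem card_filter_rect_adj_le {m n : ℕ} (p : Lex (Fin m × Fin n)) :
    (Finset.univ.filter fun q => ((zdGraph 2).comap
      (fun p : Lex (Fin m × Fin n) => ![((ofLex p).1 : ℤ), ((ofLex p).2 : ℤ)])).Adj p q).card ≤ 4 := by
  calc (Finset.univ.filter fun q => ((zdGraph 2).comap
      (fun p : Lex (Fin m × Fin n) => ![((ofLex p).1 : ℤ), ((ofLex p).2 : ℤ)])).Adj p q).card
      ≤ (({(((ofLex p).1 : ℕ) + 1, ((ofLex p).2 : ℕ)), (((ofLex p).1 : ℕ), ((ofLex p).2 : ℕ) + 1),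
          (((ofLex p).1 : ℕ) - 1, ((ofLex p).2 : ℕ)), (((ofLex p).1 : ℕ), ((ofLex p).2 : ℕ) - 1)} :
          Finset (ℕ × ℕ))).card := by
        refine Finset.card_le_card_of_injOn (fun q => (((ofLex q).1 : ℕ), ((ofLex q).2 : ℕ))) ?_ ?_
        · intro q hq
          rw [Finset.mem_coe, Finset.mem_filter, rect_adj_iff] at hq
          simp only [Finset.coe_insert, Finset.coe_singleton, Set.mem_insert_iff,
            Set.mem_singleton_iff, Prod.mk.injEq]
          omega
        · intro q _ q' _ h
          simp only [Prod.mk.injEq] at h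
          exact rect_ext h.1 h.2
    _ ≤ 4 := Finset.card_le_four

/-- The rectangle has `m n` sites. [folklore] -/
theorem card_rect (m n : ℕ) : Fintype.card (Lex (Fin m × Fin n)) = m * n := by
  rw [Fintype.card_lex, Fintype.card_prod, Fintype.card_fin, Fintype.card_fin]

/-- **Volume lower bound for rectangles**: `E₀(m,n) ≥ -5mn(2|t|+|U|+2|μ|)`. [folklore] -/
theorem neg_le_rect_groundEnergy (m n : ℕ) (t U μ : ℝ) :
    -(5 * ((m : ℝ) * n) * (2 * |t| + |U| + 2 * |μ|)) ≤
      (hamiltonianWith ((zdGraph 2).comap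
        (fun p : Lex (Fin m × Fin n) => ![((ofLex p).1 : ℤ), ((ofLex p).2 : ℤ)])) t U μ).groundEnergy := by
  have h := neg_le_gc_groundEnergy_of_degree_le ((zdGraph 2).comap
    (fun p : Lex (Fin m × Fin n) => ![((ofLex p).1 : ℤ), ((ofLex p).2 : ℤ)])) (Δ := 4)
    card_filter_rect_adj_le t U μ
  rw [card_rect] at h
  push_cast at h
  convert h using 2
  ring

/-- **Transposition invariance**: `(i,j) ↦ (j,i)` is a graph isomorphism of the `m × n` onto the
`n × m` rectangle, so `E₀(n,m) = E₀(m,n)`. [folklore] -/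
theorem rect_groundEnergy_transpose (m n : ℕ) (t U μ : ℝ) :
    (hamiltonianWith ((zdGraph 2).comap
        (fun p : Lex (Fin n × Fin m) => ![((ofLex p).1 : ℤ), ((ofLex p).2 : ℤ)])) t U μ).groundEnergy =
      (hamiltonianWith ((zdGraph 2).comap
        (fun p : Lex (Fin m × Fin n) => ![((ofLex p).1 : ℤ), ((ofLex p).2 : ℤ)])) t U μ).groundEnergy := by
  refine gc_groundEnergy_eq_of_iso
    ((zdGraph 2).comap (fun p : Lex (Fin m × Fin n) => ![((ofLex p).1 : ℤ), ((ofLex p).2 : ℤ)]))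
    ((zdGraph 2).comap (fun p : Lex (Fin n × Fin m) => ![((ofLex p).1 : ℤ), ((ofLex p).2 : ℤ)]))
    (ofLex.trans ((Equiv.prodComm (Fin m) (Fin n)).trans toLex)) (fun x y => ?_) t U μ
  rw [rect_adj_iff, rect_adj_iff]
  simp only [Equiv.trans_apply, Equiv.prodComm_apply, ofLex_toLex, Prod.fst_swap, Prod.snd_swap]
  tauto

/-- **Row cut**: the `(m₁+m₂) × n` rectangle is the ordered disjoint union of its first `m₁` rows
(an `m₁ × n` rectangle) and its last `m₂` rows (a translated `m₂ × n` rectangle), with induced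
adjacencies, so `E₀(m₁+m₂, n) ≤ E₀(m₁, n) + E₀(m₂, n)` under the hypothesis `hmin` of
`gc_groundEnergy_le_add_of_cut`. [folklore] -/
theorem rect_groundEnergy_rowCut_le
    (hmin : ∀ {Λ : Type} [LinearOrder Λ] [Fintype Λ] (G : SimpleGraph Λ) [DecidableRel G.Adj]
      (t U μ : ℝ), (hamiltonianWith G t U μ).groundEnergy =
        ⨅ N : Fin (2 * Fintype.card Λ + 1), (groundEnergyAt G t U (N : ℕ) - μ * ((N : ℕ) : ℝ)))
    {m₁ m₂ m : ℕ} (hm : m₁ + m₂ = m) (n : ℕ) (t U μ : ℝ) :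
    (hamiltonianWith ((zdGraph 2).comap
        (fun p : Lex (Fin m × Fin n) => ![((ofLex p).1 : ℤ), ((ofLex p).2 : ℤ)])) t U μ).groundEnergy ≤
      (hamiltonianWith ((zdGraph 2).comap
        (fun p : Lex (Fin m₁ × Fin n) => ![((ofLex p).1 : ℤ), ((ofLex p).2 : ℤ)])) t U μ).groundEnergy +
      (hamiltonianWith ((zdGraph 2).comap
        (fun p : Lex (Fin m₂ × Fin n) => ![((ofLex p).1 : ℤ), ((ofLex p).2 : ℤ)])) t U μ).groundEnergy := by
  subst hm
  refine gc_groundEnergy_le_add_of_cut hmin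
    ((zdGraph 2).comap (fun p : Lex (Fin m₁ × Fin n) => ![((ofLex p).1 : ℤ), ((ofLex p).2 : ℤ)]))
    ((zdGraph 2).comap (fun p : Lex (Fin m₂ × Fin n) => ![((ofLex p).1 : ℤ), ((ofLex p).2 : ℤ)]))
    ((zdGraph 2).comap (fun p : Lex (Fin (m₁ + m₂) × Fin n) => ![((ofLex p).1 : ℤ), ((ofLex p).2 : ℤ)]))
    (e₁ := fun p => toLex (Fin.castAdd m₂ (ofLex p).1, (ofLex p).2))
    (e₂ := fun q => toLex (Fin.natAdd m₁ (ofLex q).1, (ofLex q).2)) ?_ ?_ ?_ ?_ ?_ ?_ t U μ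
  · intro p p' h
    rw [Prod.Lex.lt_iff] at h ⊢
    simp only [ofLex_toLex, Fin.lt_def, Fin.ext_iff, Fin.val_castAdd] at h ⊢
    exact h
  · intro q q' h
    rw [Prod.Lex.lt_iff] at h ⊢
    simp only [ofLex_toLex, Fin.lt_def, Fin.ext_iff, Fin.val_natAdd] at h ⊢
    omega
  · intro p q
    rw [Prod.Lex.lt_iff]
    simp only [ofLex_toLex, Fin.lt_def, Fin.val_castAdd, Fin.val_natAdd]
    have := ((ofLex p).1).isLt
    omega
  · intro z
    obtain ⟨i | i, hi⟩ := finSumFinEquiv.surjective (ofLex z).1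
    · refine Or.inl ⟨toLex (i, (ofLex z).2), ?_⟩
      rw [finSumFinEquiv_apply_left] at hi
      simp only [ofLex_toLex, hi]
      rfl
    · refine Or.inr ⟨toLex (i, (ofLex z).2), ?_⟩
      rw [finSumFinEquiv_apply_right] at hi
      simp only [ofLex_toLex, hi]
      rfl
  · intro p p'
    rw [rect_adj_iff, rect_adj_iff]
    simp only [ofLex_toLex, Fin.val_castAdd]
  · intro q q'
    rw [rect_adj_iff, rect_adj_iff]
    simp only [ofLex_toLex, Fin.val_natAdd]
    omega

end WcbcsBoxTiling

open WcbcsBoxTiling in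
/-- **Stacking of Hubbard rectangles** (registered sub-goal `stub_wcbcsBoxTilingRectangles` of the
line `lro-seed-kink-bridge`, crux `WcbcsBcsConstruction`). If the grand-canonical ground energy of
every finite Hubbard graph is the minimum over particle numbers of the sector energies (the
registered stub `stub_gcGroundEnergyEqMin`), then for the free-boundary `m × n` Hubbard rectangles
(vertex type `Lex (Fin m × Fin n)`, nearest-neighbour graph pulled back from `ℤ²`) the
grand-canonical ground energy of `H(t,U) - μN` is sub-additive under stacking:
`E₀(kM, n) ≤ k E₀(M, n)` (row cuts `rect_groundEnergy_rowCut_le`, induction on `k`; `k = 0` is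
the vacuum bound on the empty rectangle). Ruelle, *Statistical Mechanics* (1969) §2.2. [folklore] -/
theorem stub_wcbcsBoxTilingRectangles :
    (∀ {Λ : Type} [LinearOrder Λ] [Fintype Λ] (G : SimpleGraph Λ) [DecidableRel G.Adj] (t U μ : ℝ),
      (hamiltonianWith G t U μ).groundEnergy =
        ⨅ N : Fin (2 * Fintype.card Λ + 1), (groundEnergyAt G t U (N : ℕ) - μ * ((N : ℕ) : ℝ))) →
    ∀ (M n k : ℕ) (t U μ : ℝ),
      (hamiltonianWith ((zdGraph 2).comap (fun p : Lex (Fin (k * M) × Fin n) => ![((ofLex p).1 : ℤ), ((ofLex p).2 : ℤ)])) t U μ).groundEnergy ≤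
        (k : ℝ) * (hamiltonianWith ((zdGraph 2).comap (fun p : Lex (Fin M × Fin n) => ![((ofLex p).1 : ℤ), ((ofLex p).2 : ℤ)])) t U μ).groundEnergy := by
  intro hmin M n k t U μ
  induction k with
  | zero =>
      exact (gc_groundEnergy_nonpos ((zdGraph 2).comap
        (fun p : Lex (Fin (0 * M) × Fin n) => ![((ofLex p).1 : ℤ), ((ofLex p).2 : ℤ)])) t U μ).trans_eq
        (by rw [Nat.cast_zero, zero_mul])
  | succ k ih =>
      have h := rect_groundEnergy_rowCut_le hmin (Nat.succ_mul k M).symm n t U μ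
      push_cast
      linarith

end Summit.HubbardSuperconductivity.HubbardSuperconductivity.Theorems
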